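import Summits.ResolutionOfSingularities.ResolutionOfSingularities.Theorems.FrobeniusLadderFInjectiveMacaulayficationProp44OfOrderReducible
import Summits.ResolutionOfSingularities.ResolutionOfSingularities.Theorems.MarkedTransferCampaignW46ThreefoldsTauTwoLocusSlice
import Literature.AlgebraicGeometry.Resolution.QuasiExcellentBlowup
import Literature.AlgebraicGeometry.Resolution.HilbertSamuelSemicontinuityExcellent
import HarnessLib

/-!
# [CoP1] Prop. 4.4 (`CossartPiltant2008_prop44`, FACT-LIST F-71) ON THE COSSART–PILTANT STAGES: the `τ ≥ 2` SLICES,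
# unconditionally, in the fact's own currency

[L1 W4.5a · crux `FInjectiveMacaulayfication` (stmt-ResolutionOfSingularities-15315); D-0154 (2) RES inputs cell, seat res-inputs-p-8b.
PROVED, fact-free, definition-free; nothing of the manuscript under adjudication is used.]

THE POINT. `CossartPiltant2008_prop44` asks, for every stage `ρ : X → S` of a Cossart–Piltant sequence over a regular excellent
integral Noetherian threefold `S` and every idealistic exponent `(J, μ)` on `X` with `μ` the maximal order, for a permissible
sequence (`IsPermissibleSeq`: integral regular centres inside `Σ = {ord = μ}`) lowering the order below `μ` everywhere. The W4.6
campaign proved the cases "`Σ` is a finite set of closed threefold points with Hironaka's `τ ≥ 2`" and "`Σ` lies on a regular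
equimultiple curve with `τ ≥ 2` plus finitely many such points off it" in its currency `CampaignW46.OrderReducible`
(`orderReducible_of_finite_two_le_tau`, `orderReducible_of_two_le_tau_locus`; Cossart–Piltant 2008 Lemma 4.3 (1)–(3) and the
`τ = 2` tail of the proof of Prop. 4.4, p. 11, `false_of_nearChain_tau_two`), under a G-ring hypothesis at the bad points. This file
discharges that hypothesis on the Cossart–Piltant stages (they are quasi-excellent: `IsRegularCentreBlowupSeq.isQuasiExcellent`,
Stacks 07QU; local rings of quasi-excellent schemes are G-rings: `Scheme.isGRing_stalk_of_isQuasiExcellent`, Matsumura §32) and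
translates through the dictionary `CP2008Prop44.exists_isPermissibleSeq_of_orderReducible`
(`…Prop44OfOrderReducible.lean`), giving the CONCLUSION OF PROP. 4.4 AT ITS OWN QUANTIFIERS for these configurations of `Σ`:

* `isGRing_stalk_of_isRegularCentreBlowupSeq` — local rings of Cossart–Piltant stages over an excellent `S` are G-rings;
* `prop44_conclusion_of_finite_two_le_tau` — `Σ` a finite set of closed points of embedding dimension `3` with `τ ≥ 2`;
* `prop44_conclusion_of_two_le_tau_locus` — `Σ` ⊆ a regular equimultiple curve of embedding codimension `2` with `τ ≥ 2` along it,
  plus finitely many closed threefold points with `τ ≥ 2` off it.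

What these do NOT cover (the open part of F-71 as of 2026-08-28, cell files `plan/inputs/F71-CENSUS-v1.md` / `F71-CENSUS-p8b-notes.md`):
points or curves of `Σ` with `τ = 1` (Cossart–Piltant 2008 Lemma 4.5; CJS 2020 Thm. 13.7–14.4), several / singular / intersecting
one-dimensional components of `Σ` (steps 1–3 of the algorithm), and closed points of `Σ` of local dimension `2` on a non-Jacobson `S`.
`CossartPiltant2008_prop44` itself is NOT proved; resolution in dimension `≥ 4` / positive characteristic is NOT proved. AI-written;
AI review is weaker than expert review.

## References
* V. Cossart, O. Piltant, *Resolution of singularities of threefolds in positive characteristic I*, J. Algebra 320 (2008), Lemma 4.3,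
  Prop. 4.4 (proof, pp. 9–11). [CossartPiltant2008]
* H. Matsumura, *Commutative Ring Theory* (1986), §32. [Matsumura1987]
* The Stacks Project, Tag 07QU. [StacksProject]
-/

-- `Summit.<Summit>.<Sub>.Theorems` with `Sub = Summit` (single-conjunct summit, D-0017)
set_option linter.dupNamespace false

noncomputable section

open CategoryTheory AlgebraicGeometry TopologicalSpace IsLocalRing
open Literature.AlgebraicGeometry.Resolution Scheme.IdealSheafData

namespace Summit.ResolutionOfSingularities.ResolutionOfSingularities.Theorems

namespace CP2008Prop44

universe u

/-- **Local rings of Cossart–Piltant stages over an excellent scheme are G-rings** (the stage is quasi-excellent, Stacks 07QU;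
quasi-excellent schemes have G-ring stalks, Matsumura §32). [cite: StacksProject, Tag 07QU] [cite: Matsumura1987, §32 p. 260] -/
theorem isGRing_stalk_of_isRegularCentreBlowupSeq {X S : Scheme.{u}}
    [IsLocallyNoetherian S] {ρ : X ⟶ S} {I : S.IdealSheafData} (hρ : IsRegularCentreBlowupSeq ρ I)
    (hexc : Scheme.IsExcellent S) (x : X) : IsGRing (X.presheaf.stalk x) :=
  Scheme.isGRing_stalk_of_isQuasiExcellent (hρ.isQuasiExcellent hexc) x

/-- **Prop. 4.4 on a Cossart–Piltant stage whose `Σ` is a finite set of closed threefold points with `τ ≥ 2`.** Let `S` be regular,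
excellent, integral and Noetherian, `ρ : X → S` a stage of a Cossart–Piltant sequence (`X` integral Noetherian), `(J, μ)` an idealistic
exponent on `X` with `μ ≥ 1` and `ord_x J ≤ μ` everywhere, and suppose every point of order `μ` lies in a finite set `T` of CLOSED
points at each of which the local ring has embedding dimension `3` and Hironaka's `τ ≥ 2`. Then there is a permissible sequence
`π : X' → X` for `(J, μ)` (integral regular centres inside `{ord = μ}`, weak transforms) with `ord J' < μ` everywhere — the
conclusion of `CossartPiltant2008_prop44` for this input. (W4.6 slice `orderReducible_of_finite_two_le_tau` — successive blowing ups
of the closed points, the near point over a `τ = 2` point being unique, rational and again a `τ ≥ 2` threefold point, infinite chains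
excluded by `false_of_nearChain_tau_two` — + the G-ring property of the stage + the dictionary.)
[cite: CossartPiltant2008, Lemma 4.3 (1) (3), Prop. 4.4 (proof, p. 11)] -/
theorem prop44_conclusion_of_finite_two_le_tau (S : Scheme.{u}) [IsIntegral S] [IsNoetherian S]
    (hS : Scheme.IsRegular S) (hexc : Scheme.IsExcellent S) (I : S.IdealSheafData)
    (X : Scheme.{u}) (ρ : X ⟶ S) [IsIntegral X] [IsNoetherian X] (hρ : IsRegularCentreBlowupSeq ρ I)
    (J : X.IdealSheafData) (μ : ℕ) (hμ : 1 ≤ μ) (hle : ∀ x, idealOrder J x ≤ μ)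
    (T : Set X) (hT : T.Finite) (hTc : ∀ x ∈ T, IsClosed ({x} : Set X))
    (hJT : ∀ x : X, (μ : ℕ∞) ≤ idealOrder J x → x ∈ T) (hord : ∀ x ∈ T, idealOrder J x = μ)
    (hdim : ∀ x ∈ T, (maximalIdeal (X.presheaf.stalk x)).spanFinrank = 3)
    (hτ : ∀ x ∈ T, haveI := hρ.isRegular hS x; 2 ≤ stalkTau J x μ) :
    ∃ (X' : Scheme.{u}) (π : X' ⟶ X) (J' : X'.IdealSheafData), IsPermissibleSeq π J μ J' ∧ ∀ x, idealOrder J' x < μ :=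
  exists_isPermissibleSeq_of_orderReducible (hρ.isRegular hS) hle
    (CampaignW46.orderReducible_of_finite_two_le_tau (hρ.isRegular hS) J hμ T hT hTc hJT hord hdim hτ
      fun x _ => isGRing_stalk_of_isRegularCentreBlowupSeq hρ hexc x)

/-- **Prop. 4.4 on a Cossart–Piltant stage whose `Σ` lies on a regular equimultiple `τ ≥ 2` curve plus finitely many `τ ≥ 2`
threefold points off it.** Same setting; `Y ⊆ X` closed with `V(𝓘(Y))` regular, `ord = μ` on `Y`, at each point of `Y` the ideal
`𝓘_{Y,y}` generated by two members of a regular system of parameters and `τ_y(J, μ) ≥ 2` (a regular curve through threefold points,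
or through its own generic point); `T` a finite set of closed threefold points off `Y` with `ord = μ` and `τ ≥ 2`; every point of
order `μ` on `Y` or in `T`. Then the conclusion of `CossartPiltant2008_prop44` holds for `(X, J, μ)`. (W4.6 slice
`orderReducible_of_two_le_tau_locus`: blow up `Y` once — no near points over a `τ ≥ 2` curve, Lemma 4.3 (2) — and the points as
above; patching `OrderReducible.of_opens_finite`.) [cite: CossartPiltant2008, Lemma 4.3 (2) (3), Prop. 4.4 (proof)] -/
theorem prop44_conclusion_of_two_le_tau_locus (S : Scheme.{u}) [IsIntegral S] [IsNoetherian S]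
    (hS : Scheme.IsRegular S) (hexc : Scheme.IsExcellent S) (I : S.IdealSheafData)
    (X : Scheme.{u}) (ρ : X ⟶ S) [IsIntegral X] [IsNoetherian X] (hρ : IsRegularCentreBlowupSeq ρ I)
    (J : X.IdealSheafData) (μ : ℕ) (hμ : 1 ≤ μ) (hle : ∀ x, idealOrder J x ≤ μ)
    (Y : Closeds X) (hreg : Scheme.IsRegular (vanishingIdeal Y).subscheme)
    (hordY : ∀ y ∈ (Y : Set X), idealOrder J y = μ)
    (hcurve : ∀ y ∈ (Y : Set X), haveI := hρ.isRegular hS y; ∃ c : Fin 2 → X.presheaf.stalk y, IsRsopPart c ∧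
      Ideal.span (Set.range c) = stalkIdeal (vanishingIdeal Y) y ∧ 2 ≤ stalkTau J y μ)
    (T : Set X) (hT : T.Finite) (hTc : ∀ x ∈ T, IsClosed ({x} : Set X)) (hTY : Disjoint T (Y : Set X))
    (hord₀ : ∀ x ∈ T, idealOrder J x = μ) (hdim₀ : ∀ x ∈ T, (maximalIdeal (X.presheaf.stalk x)).spanFinrank = 3)
    (hτ₀ : ∀ x ∈ T, haveI := hρ.isRegular hS x; 2 ≤ stalkTau J x μ)
    (hJ : ∀ x : X, (μ : ℕ∞) ≤ idealOrder J x → x ∈ (Y : Set X) ∨ x ∈ T) :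
    ∃ (X' : Scheme.{u}) (π : X' ⟶ X) (J' : X'.IdealSheafData), IsPermissibleSeq π J μ J' ∧ ∀ x, idealOrder J' x < μ :=
  exists_isPermissibleSeq_of_orderReducible (hρ.isRegular hS) hle
    (CampaignW46.orderReducible_of_two_le_tau_locus (hρ.isRegular hS) J hμ Y hreg hordY hcurve T hT hTc hTY hord₀
      hdim₀ hτ₀ (fun x _ => isGRing_stalk_of_isRegularCentreBlowupSeq hρ hexc x) hJ)

end CP2008Prop44

end Summit.ResolutionOfSingularities.ResolutionOfSingularities.Theorems

end
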